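import Literature.MathematicalPhysics.QuantumFieldTheory.Balaban1983to89.B4CubeFieldHyps22
import Literature.MathematicalPhysics.QuantumFieldTheory.Balaban1983to89.B4Lemma22HolderBox

/-!
# [B4] LEMMA 2.2 (2.16), THE HÖLDER MEMBER «‖G_k(□,Ã)f‖_{1,α} ≤ c₁‖f‖_∞», AT THE CUBE CONFIGURATION `Ã_j = A₀ + θ_jA′`
# OF A (1.7)-REGULAR FIELD — every field hypothesis of the lineage's certificate discharged, the size of the constant
# part removed by gauge covariance, only «for e sufficiently small» left [Balaban1983RegularityDecay]

statement-level skeleton of published theorems with citation tags; proofs where landed; nothing here is a claim about the Yang–Mills mass gap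

CITATION HEADER.  T. Bałaban, *Regularity and decay of lattice Green's functions*, Commun. Math. Phys. **89** (1983)
571–597, doi:10.1007/bf01214744 [Balaban1983RegularityDecay] (cell paper B4; held text
`paper:balaban1983-cmp89-regularity-decay`, journal page = PDF page + 570; pp. 573, 575, 577–578, 581).  PDF held:
yes.  Unit `lit-balaban-p35` gen 6 (Phase-2 proof seat), HOME `run/shared/lean/pub/lit-balaban/`.  WHAT IS REPRODUCED:
SKELETON row **B4.Lem2.2** ((2.16), the Hölder member, at the interior-cube configurations `Ã_j` of p. 575 for a field
assumed only (1.7)-regular) and **B4.Thm@573** (the per-cube Hölder input of (1.9) by the walk route).  Imports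
`B4CubeFieldHyps22` (p35 gen 6: `cubeField`, `cubeComp`, `cubeField_hyps`, `cube_threshold`, `smallness_of_le`,
charge scaling) and b04's `B4Lemma22HolderBox` (`lemma22_16_holder_field_explicit`: (2.16) at `Ã = A₀ + A′` under
explicit hypotheses incl. «|κA₀,ν| ≤ θ/n»).

WHAT IS PRINTED.  p. 577–578: «Lemma 2.2. Let a rectangular parallelepiped □ be a sum of few large blocks (e.g., as in
the case of the cubes □_j), and let Ã be a regular vector field configuration in the sense of Proposition I.2.1,
constant in a neighbourhood of the boundary of □. Then for e sufficiently small and α < 1, there exists a constant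
c₁ depending on d, α only, such that ‖G_k(□,Ã)f‖_{1,α} ≤ c₁‖f‖_∞, (2.16)»; (2.14): «‖f‖_{1,α} = max{sup_x|f(x)|,
sup_{x,μ}|(D^η_{A,μ}f)(x)|, sup_{x,x′,μ}|x′ − x|^{−α}|U(A(Γ_{x,x′}))(D^η_{A,μ}f)(x′) − (D^η_{A,μ}f)(x)|}»; p. 581:
«Lemma 2.2 in the case of a constant configuration A₀ is equivalent to the case of configuration A₀ = 0 by the same
argument with the gauge transformation as before»; p. 575: «Ã_j = A₀ + θ_jA′ … Of course it satisfies the regularity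
condition (1.4) with another constant c».

WHAT THIS MODULE PROVES (all in full; box `□ = Π_μ[0, nM_μ)`, `n = L^k`, `M_μ ≤ S`, the cube of the label `j`
inside (`K(j_μ + 1) ≤ M_μ`, `j_μ ≥ 1`), `nK ≥ 16`; `A` in component form, (1.7)-regular on `□` with constants
`c, β > 0`; coupling `e/n`; staircase contours).
* §1 THE TRANSVERSE LIPSCHITZ BOUND the Hölder certificate asks of `A′` («|∂^η_μA′| ≤ c′e^{β−1}» in every
  direction): `abs_sub_le_of_steps` (telescoping along an up-going staircase for any function with a step bound on
  the bonds of the box), **`abs_cubeComp_sub_le`** (`|(Ã_j)_ν(x′) − (Ã_j)_ν(x)| ≤ 2(d+1)|x′ − x|_∞·δ(1 +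
  D1(θ)(d+1)T/(nK))` for any two box sites, through `x ⊓ x′`), `cubeFluct_fwd_eq` (`(θ_jA′)_{⟨x,x+e_μ⟩} = (Ã_j)_μ(x)
  − A₀,μ`).
* §2 GAUGE COVARIANCE OF THE HÖLDER QUANTITY: `holder_gauge` (for orthogonal `g`, transporter `g(x)Tg(x′)ᵀ` and
  operators `𝒢D𝒢ᵀ`, `𝒢G𝒢ᵀ`: `|g(x)Tg(x′)ᵀ·(𝒢D𝒢ᵀ𝒢G𝒢ᵀΦ)(x′) − (𝒢D𝒢ᵀ𝒢G𝒢ᵀΦ)(x)| = |T·(DG𝒢ᵀΦ)(x′) − (DG𝒢ᵀΦ)(x)|`),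
  `constBond_add_eq_bondGauge` (`A₀ + A′ = (A′)^λ`, `λ = −⟨A₀,·⟩`: the constant part is pure gauge).
* §3 **`holder_threshold`** — the threshold of file 2 strengthened by `2(d+1)θ′(e) ≤ 1` (the transverse constant).
* §4 **`lemma22_holder_cubeField`** — (2.16), HÖLDER MEMBER, AT `Ã_j` FOR A (1.7)-REGULAR FIELD: there is `C > 0`
  (for `α ∈ [0,1)`: the lineage's `2c₁` at charge `1`) such that for every `(c, β)`, side bound `S`, cube size
  `K ≥ 1` there is `e₁ > 0` with: for every mesh (`nK ≥ 16`), `a, m²` of the windows, box, label, (1.7)-regular `A`,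
  `0 < e ≤ e₁`, direction `μ`, sites `x ≠ x′` with their forward `μ`-bonds in `□`, EVERY nearest-neighbour chain
  `Γ` from `x` to `x′` with `|Γ| ≤ (d+1)|x′ − x|_∞`, and every `Φ`:
  `(n/|x′−x|_∞)^α·|U(Ã_j(Γ))(D^η_{Ã_j,μ}G_k(□,Ã_j)Φ)(x′) − (D^η_{Ã_j,μ}G_k(□,Ã_j)Φ)(x)| ≤ C‖Φ‖_∞`.
  Mechanism: `lemma22_16_holder_field_explicit` at charge `1`, constant part `0` and fluctuation `(e/n)θ_jA′` — its
  hypotheses `hA′`/`hder`/`hbd` from `cubeField_hyps`, the transverse bound from §1, `τ = (d+1)θ` from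
  `B4Lemma22SupStair.stair_lsum_le`, invertibility from `B4Lemma22Invertible.opA_stair_isUnit_det`, «|κA₀,ν| ≤ θ/n»
  VACUOUS at `A₀ = 0`, smallness from `holder_threshold`; then the constant part `(e/n)A(0)` of `(e/n)Ã_j` is put
  back by the gauge transformation `λ` (§2: `b4Green_bondGauge`, `covDeriv_gauge`, `transport_gauge`,
  `supN_gauge_transpose`) and the charge by `fieldLink_smul`.

HONEST SCOPE.  (i) As `B4Lemma22HolderBox`: the lineage's ABELIAN one-parameter flow (the splitting of the transport
used there); boxes; every nearest-neighbour chain with `|Γ| ≤ (d+1)|x′−x|_∞` (covers the print's shortest contour);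
`0 ≤ α < 1`.  (ii) The sup members of (2.14) at `Ã_j` are `B4Eq220CubeField.lemma22_sup_cubeField`; together the
three members give (2.16) at `Ã_j` — the typed `B4.Lemma22Printed` family instance is NOT assembled here.
(iii) Constants: `C` depends on `(d, N, flow Lipschitz constant, L, a₋, a₊, m²₊, α)`, `e₁` in addition on
`(c, β, S, K)`.  Theorems only; no `def`, no `Prop` fact, no `sorry`; axioms standard.
-/

namespace Literature.MathematicalPhysics.QuantumFieldTheory.Balaban1983to89.B4Lemma22HolderCubeField

open Finset Matrix
open Literature.MathematicalPhysics.QuantumFieldTheory.Balaban1983to89.B4GaugeCovariance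
open Literature.MathematicalPhysics.QuantumFieldTheory.Balaban1983to89.B4Reflection242 (boxDom nbrs mem_boxDom mem_nbrs)
open Literature.MathematicalPhysics.QuantumFieldTheory.Balaban1983to89.B4Lower18Regular (e1 e1_apply_self e1_apply_ne
  baseEmb stairContour stair pathEnd_stair length_stair_le mem_stair mem_boxDom_of_between lsum stairContour_end)
open Literature.MathematicalPhysics.QuantumFieldTheory.Balaban1983to89.B4Lower18RegularRegion (pathRel_stairL_up
  pathRel_and pathRel_chain abs_sub_le_of_pathRel)
open Literature.MathematicalPhysics.QuantumFieldTheory.Balaban1983to89.B4Lemma21Region (siteNorm covDeriv)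
open Literature.MathematicalPhysics.QuantumFieldTheory.Balaban1983to89.B4ContourShift (supNorm supNorm_nonneg
  exists_supNorm_eq abs_le_supNorm)
open Literature.MathematicalPhysics.QuantumFieldTheory.Balaban1983to89.B4Lemma22Reduce231 (supN supN_nonneg)
open Literature.MathematicalPhysics.QuantumFieldTheory.Balaban1983to89.B4Lemma22ReduceZero (Box opA greenA derivA
  siteNorm_gauge_mulVec supN_gauge_transpose conj_mul_conj covDeriv_gauge)
open Literature.MathematicalPhysics.QuantumFieldTheory.Balaban1983to89.B4Lemma22SupStair (stair_lsum_le)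
open Literature.MathematicalPhysics.QuantumFieldTheory.Balaban1983to89.B4Lemma22Invertible (opA_stair_isUnit_det)
open Literature.MathematicalPhysics.QuantumFieldTheory.Balaban1983to89.B4Lemma22HolderBox (IsNNChain
  lemma22_16_holder_field_explicit)
open Literature.MathematicalPhysics.QuantumFieldTheory.Balaban1983to89.B4PartitionUnity22 (thetaProf D1 D1_nonneg
  contDiff_thetaProf hasCompactSupport_thetaProf)
open Literature.MathematicalPhysics.QuantumFieldTheory.Balaban1983to89.B4CubeFields22
open Literature.MathematicalPhysics.QuantumFieldTheory.Balaban1983to89.B4CubeFieldHyps22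

noncomputable section

variable {d : ℕ}

/-! ## §1. The transverse Lipschitz bound of `Ã_j` from (1.7) -/

section Transverse

variable {N : Fin (d + 1) → ℕ}

/-- telescoping along the up-going staircase from `m` to `x ≥ m` inside the box, for any function with a step bound on
the bonds of the box: `|f(x) − f(m)| ≤ (d+1)·Kz·b` when `x_i − m_i ≤ Kz`. [folklore] -/
private theorem abs_sub_le_of_steps {f : (Fin (d + 1) → ℤ) → ℝ} {b : ℝ} (hb : 0 ≤ b)
    (hstep : ∀ p ∈ boxDom N, ∀ μ, p + e1 μ ∈ boxDom N → |f (p + e1 μ) - f p| ≤ b)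
    {m x : Fin (d + 1) → ℤ} (hm : m ∈ boxDom N) (hx : x ∈ boxDom N) (hle : m ≤ x) {Kz : ℤ}
    (hK : ∀ i, x i - m i ≤ Kz) : |f x - f m| ≤ ((d : ℝ) + 1) * Kz * b := by
  have hup : B4Lower18Regular.PathRel (fun u v : Fin (d + 1) → ℤ => ∃ μ, v = u + e1 μ) m (stair m x) :=
    pathRel_stairL_up x (List.finRange (d + 1)) m
  have hmem : ∀ z ∈ stair m x, z ∈ boxDom N := fun z hz =>
    mem_boxDom_of_between hm hx (mem_stair hle hz).1 (mem_stair hle hz).2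
  have hpath := pathRel_chain (r := fun u v : Fin (d + 1) → ℤ => ∃ μ, v = u + e1 μ)
    (P := fun z => z ∈ boxDom N) _ _ hm (pathRel_and _ _ hup hmem)
  have hst : ∀ p q : Fin (d + 1) → ℤ,
      (p ∈ boxDom N ∧ ((∃ μ, q = p + e1 μ) ∧ q ∈ boxDom N)) → |f q - f p| ≤ b := by
    rintro p q ⟨hp, ⟨μ, rfl⟩, hq⟩
    exact hstep p hp μ hq
  have htel := abs_sub_le_of_pathRel (f := f) hst _ _ hpath
  rw [pathEnd_stair hle] at htel
  have hlen : ((stair m x).length : ℝ) ≤ ((d : ℝ) + 1) * Kz := by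
    have h := length_stair_le hle (K := Kz) hK
    exact_mod_cast h
  exact htel.trans (mul_le_mul_of_nonneg_right hlen hb)

/-- the coordinatewise minimum of two box sites is a box site. [folklore] -/
private theorem inf_mem_boxDom {x x' : Fin (d + 1) → ℤ} (hx : x ∈ boxDom N) (hx' : x' ∈ boxDom N) :
    x ⊓ x' ∈ boxDom N := by
  rw [mem_boxDom] at hx hx' ⊢
  intro i
  rw [Pi.inf_apply]
  exact ⟨le_inf (hx i).1 (hx' i).1, lt_of_le_of_lt inf_le_left (hx i).2⟩

/-- the excess of a site over the minimum is bounded by the sup distance: `x_i − (x ⊓ x′)_i ≤ |x′ − x|_∞`. [folklore] -/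
private theorem sub_inf_le_supNorm (x x' : Fin (d + 1) → ℤ) {Kz : ℤ} (hKz : supNorm (x' - x) = ((Kz : ℤ) : ℝ))
    (i : Fin (d + 1)) : x i - (x ⊓ x') i ≤ Kz ∧ x' i - (x ⊓ x') i ≤ Kz := by
  have h1 : (((|(x' - x) i| : ℤ)) : ℝ) ≤ supNorm (x' - x) := abs_le_supNorm (x' - x) i
  rw [hKz] at h1
  have h2 : |(x' - x) i| ≤ Kz := by exact_mod_cast h1
  rw [Pi.sub_apply, abs_le] at h2
  rw [Pi.inf_apply]
  constructor
  · rcases le_total (x i) (x' i) with h | h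
    · rw [inf_eq_left.2 h]; omega
    · rw [inf_eq_right.2 h]; omega
  · rcases le_total (x i) (x' i) with h | h
    · rw [inf_eq_left.2 h]; omega
    · rw [inf_eq_right.2 h]; omega

/-- **THE TRANSVERSE LIPSCHITZ BOUND OF `Ã_j`** («A′ is regular», every direction): for any two sites `x, x′` of the
box `Π_μ[0, N_μ)` (`N_μ ≤ T`, `A` with forward differences `≤ δ` on it),
`|(Ã_j)_ν(x′) − (Ã_j)_ν(x)| ≤ 2(d+1)|x′ − x|_∞·δ(1 + D1(θ)(d+1)T/(nK))` — two staircases through `x ⊓ x′`, each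
step by `cubeComp_regular`. [cite: Balaban1983RegularityDecay, §2 p. 575 «A′ is regular … |∂^η_μA′| ≤ c′e^{β−1}»] -/
theorem abs_cubeComp_sub_le (hN : ∀ i, 1 ≤ N i) {T : ℤ} (hT : ∀ i, (N i : ℤ) ≤ T)
    {Ac : (Fin (d + 1) → ℤ) → Fin (d + 1) → ℝ} {δ : ℝ} (hδ : 0 ≤ δ)
    (h17 : ∀ x ∈ boxDom N, ∀ μ ν : Fin (d + 1), |Ac (x + e1 μ) ν - Ac x ν| ≤ δ)
    {n K : ℕ} (hn : 1 ≤ n) (hK : 1 ≤ K) (j : Fin (d + 1) → ℤ) {x x' : Fin (d + 1) → ℤ} (hx : x ∈ boxDom N)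
    (hx' : x' ∈ boxDom N) (ν : Fin (d + 1)) :
    |cubeComp n K j (Ac 0) Ac x' ν - cubeComp n K j (Ac 0) Ac x ν|
      ≤ 2 * (((d : ℝ) + 1) * supNorm (x' - x)) * (δ * (1 + D1 thetaProf * (((d : ℝ) + 1) * T) / ((n : ℝ) * K))) := by
  set b : ℝ := δ * (1 + D1 thetaProf * (((d : ℝ) + 1) * T) / ((n : ℝ) * K)) with hb_def
  have hT0 : (0 : ℝ) ≤ T := by
    have h := hT 0
    have : (0 : ℤ) ≤ T := le_trans (by positivity) h
    exact_mod_cast this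
  have hb : 0 ≤ b := by
    have := D1_nonneg contDiff_thetaProf hasCompactSupport_thetaProf
    rw [hb_def]; positivity
  have hstep : ∀ p ∈ boxDom N, ∀ μ, p + e1 μ ∈ boxDom N →
      |cubeComp n K j (Ac 0) Ac (p + e1 μ) ν - cubeComp n K j (Ac 0) Ac p ν| ≤ b :=
    fun p hp μ hpμ => cubeComp_regular hN hT hδ h17 hn hK j hp hpμ ν
  obtain ⟨i₀, hi₀⟩ := exists_supNorm_eq (x' - x)
  set Kz : ℤ := |(x' - x) i₀| with hKz_def
  have hm : x ⊓ x' ∈ boxDom N := inf_mem_boxDom hx hx'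
  have h1 : |cubeComp n K j (Ac 0) Ac x ν - cubeComp n K j (Ac 0) Ac (x ⊓ x') ν| ≤ ((d : ℝ) + 1) * Kz * b :=
    abs_sub_le_of_steps (f := fun p => cubeComp n K j (Ac 0) Ac p ν) hb hstep hm hx inf_le_left
      fun i => (sub_inf_le_supNorm x x' hi₀ i).1
  have h2 : |cubeComp n K j (Ac 0) Ac x' ν - cubeComp n K j (Ac 0) Ac (x ⊓ x') ν| ≤ ((d : ℝ) + 1) * Kz * b :=
    abs_sub_le_of_steps (f := fun p => cubeComp n K j (Ac 0) Ac p ν) hb hstep hm hx' inf_le_right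
      fun i => (sub_inf_le_supNorm x x' hi₀ i).2
  have hKs : (((Kz : ℤ)) : ℝ) = supNorm (x' - x) := hi₀.symm
  calc |cubeComp n K j (Ac 0) Ac x' ν - cubeComp n K j (Ac 0) Ac x ν|
      = |(cubeComp n K j (Ac 0) Ac x' ν - cubeComp n K j (Ac 0) Ac (x ⊓ x') ν)
          - (cubeComp n K j (Ac 0) Ac x ν - cubeComp n K j (Ac 0) Ac (x ⊓ x') ν)| := by ring_nf
    _ ≤ |cubeComp n K j (Ac 0) Ac x' ν - cubeComp n K j (Ac 0) Ac (x ⊓ x') ν|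
          + |cubeComp n K j (Ac 0) Ac x ν - cubeComp n K j (Ac 0) Ac (x ⊓ x') ν| := abs_sub _ _
    _ ≤ ((d : ℝ) + 1) * Kz * b + ((d : ℝ) + 1) * Kz * b := add_le_add h2 h1
    _ = 2 * (((d : ℝ) + 1) * supNorm (x' - x)) * b := by rw [← hKs]; ring

/-- `(θ_jA′)_{⟨x,x+e_μ⟩} = (Ã_j)_μ(x) − A₀,μ` (the fluctuation on a forward bond through the component form).
[cite: Balaban1983RegularityDecay, §2 p. 575] -/
theorem cubeFluct_fwd_eq {R : Finset (Fin (d + 1) → ℤ)} (n K : ℕ) (j : Fin (d + 1) → ℤ) (A₀ : Fin (d + 1) → ℝ)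
    (Ac : (Fin (d + 1) → ℤ) → Fin (d + 1) → ℝ) {x y : ↥R} {μ : Fin (d + 1)} (hy : y.1 = x.1 + e1 μ) :
    cubeFluct R n K j A₀ Ac x y = cubeComp n K j A₀ Ac x.1 μ - A₀ μ := by
  rw [cubeFluct_step n K j A₀ Ac hy, cubeComp_apply]
  ring

end Transverse

/-! ## §2. Gauge covariance of the Hölder quantity; the constant part is pure gauge -/

section Gauge

variable {ι : Type} [Fintype ι] [DecidableEq ι]

/-- **THE HÖLDER QUANTITY IS GAUGE COVARIANT**: with an orthogonal `g`, transporter `g(x)·T·g(x′)ᵀ` and operators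
`𝒢D𝒢ᵀ`, `𝒢G𝒢ᵀ` (`𝒢 = ⊕g`), `|g(x)Tg(x′)ᵀ·(𝒢D𝒢ᵀ·𝒢G𝒢ᵀΦ)(x′) − (𝒢D𝒢ᵀ·𝒢G𝒢ᵀΦ)(x)| = |T·(DG𝒢ᵀΦ)(x′) − (DG𝒢ᵀΦ)(x)|` —
«by the same argument with the gauge transformation as before». [cite: Balaban1983RegularityDecay, p. 581] -/
theorem holder_gauge {R : Type*} [Fintype R] [DecidableEq R] {g : R → Matrix ι ι ℝ} (hg : IsGauge g)
    (T : Matrix ι ι ℝ) (D G : Matrix (R × ι) (R × ι) ℝ) (x x' : R) (Φ : R × ι → ℝ) :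
    siteNorm ((g x * T * (g x')ᵀ)
        *ᵥ fld ((blockDiag g * D * (blockDiag g)ᵀ) *ᵥ ((blockDiag g * G * (blockDiag g)ᵀ) *ᵥ Φ)) x'
        - fld ((blockDiag g * D * (blockDiag g)ᵀ) *ᵥ ((blockDiag g * G * (blockDiag g)ᵀ) *ᵥ Φ)) x)
      = siteNorm (T *ᵥ fld (D *ᵥ (G *ᵥ ((blockDiag g)ᵀ *ᵥ Φ))) x'
          - fld (D *ᵥ (G *ᵥ ((blockDiag g)ᵀ *ᵥ Φ))) x) := by
  have e1 : (blockDiag g * D * (blockDiag g)ᵀ) *ᵥ ((blockDiag g * G * (blockDiag g)ᵀ) *ᵥ Φ)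
      = blockDiag g *ᵥ (D *ᵥ (G *ᵥ ((blockDiag g)ᵀ *ᵥ Φ))) := by
    rw [mulVec_mulVec, conj_mul_conj hg]
    simp only [← mulVec_mulVec]
  rw [e1, fld_blockDiag_mulVec, fld_blockDiag_mulVec]
  have h1 : (g x * T * (g x')ᵀ) *ᵥ (g x' *ᵥ fld (D *ᵥ (G *ᵥ ((blockDiag g)ᵀ *ᵥ Φ))) x')
      = g x *ᵥ (T *ᵥ fld (D *ᵥ (G *ᵥ ((blockDiag g)ᵀ *ᵥ Φ))) x') := by
    rw [mulVec_mulVec, Matrix.mul_assoc (g x * T), hg x', Matrix.mul_one, ← mulVec_mulVec]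
  rw [h1, ← Matrix.mulVec_sub, siteNorm_gauge_mulVec hg]

/-- **THE CONSTANT PART IS PURE GAUGE**: `A₀ + A′ = (A′)^λ` with the linear gauge function `λ = −⟨A₀,·⟩`
(`B4GaugeCovariance.bondGauge`/`linGauge`). [cite: Balaban1983RegularityDecay, p. 581 «A₀ = 0 by … the gauge
transformation»] -/
theorem constBond_add_eq_bondGauge {X : Type*} (A₀ : Fin (d + 1) → ℝ) (pos : X → Fin (d + 1) → ℤ)
    (A' : X → X → ℝ) : constBond A₀ pos + A' = bondGauge (linGauge A₀ pos) A' := by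
  rw [constBond_eq_bondGauge]
  funext u v
  simp only [Pi.add_apply, Pi.zero_apply, bondGauge]
  ring

/-- the zero constant configuration is the zero bond function. [folklore] -/
private theorem constBond_zero {X : Type*} (pos : X → Fin (d + 1) → ℤ) :
    constBond (0 : Fin (d + 1) → ℝ) pos = 0 := by
  funext u v
  simp [constBond]

end Gauge

/-! ## §3. The threshold with the transverse constant -/

section Threshold

/-- **«FOR e SUFFICIENTLY SMALL» FOR THE HÖLDER MEMBER**: as `B4CubeFieldHyps22.cubeField_threshold` (θ(e) ≤ 1 and the
two smallness conditions for every `a_k` of the window) and in addition `2(d+1)θ′(e) ≤ 1` (the transverse constant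
of §1). [cite: Balaban1983RegularityDecay, Theorem p. 573 «for e sufficiently small», p. 581] -/
theorem holder_threshold (d : ℕ) {ℓ₁ c amin aplus creg β : ℝ} (hℓ₁ : 0 ≤ ℓ₁) (hc : 0 ≤ c)
    (ha : 0 < amin) (hcreg : 0 ≤ creg) (hβ : 0 < β) (S K : ℕ) :
    ∃ e₁ : ℝ, 0 < e₁ ∧ ∀ e : ℝ, 0 < e → e ≤ e₁ → ∀ ak : ℝ, 3 / 4 * amin ≤ ak → ak ≤ aplus →
      ((d : ℝ) + 1) * S * creg * e ^ β ≤ 1 ∧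
      2 * ((d : ℝ) + 1) * (creg * e ^ β * (1 + D1 thetaProf * (((d : ℝ) + 1) * S) / K)) ≤ 1 ∧
      ℓ₁ ^ 2 * (((d : ℝ) + 1) * S * creg * e ^ β) ^ 2 * ((d : ℝ) + 1) * (1 + ak * ((d : ℝ) + 1)) ≤ min 2 ak / 4 ∧
      ((d : ℝ) + 2) * c * (((d : ℝ) + 1) * ℓ₁ * (((d : ℝ) + 1) * S * creg * e ^ β
          + creg * e ^ β * (1 + D1 thetaProf * (((d : ℝ) + 1) * S) / K))
        + ((d : ℝ) + 1) * ℓ₁ * (((d : ℝ) + 1) * S * creg * e ^ β)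
        + ((d : ℝ) + 1) * ℓ₁ ^ 2 * (((d : ℝ) + 1) * S * creg * e ^ β) ^ 2
        + ak * (ℓ₁ * (((d : ℝ) + 1) * (((d : ℝ) + 1) * S * creg * e ^ β))
          * (2 + ℓ₁ * (((d : ℝ) + 1) * (((d : ℝ) + 1) * S * creg * e ^ β))))) ≤ 1 / 2 := by
  have hD : 0 ≤ D1 thetaProf := D1_nonneg contDiff_thetaProf hasCompactSupport_thetaProf
  obtain ⟨e₁, he₁, h1⟩ := cubeField_threshold d (c := c) (aplus := aplus) hℓ₁ hc ha hcreg hβ S K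
  obtain ⟨e₂, he₂, h2⟩ := cube_threshold (C := 2 * ((d : ℝ) + 1) * (creg * (1 + D1 thetaProf * (((d : ℝ) + 1) * S) / K)))
    (C' := 0) (t := 1) (by positivity) one_pos hβ
  refine ⟨min e₁ e₂, lt_min he₁ he₂, fun e he hle ak hak1 hak2 => ?_⟩
  obtain ⟨hθ1, hS1, hS2⟩ := h1 e he (hle.trans (min_le_left _ _)) ak hak1 hak2
  obtain ⟨hT, -⟩ := h2 e he (hle.trans (min_le_right _ _))
  refine ⟨hθ1, ?_, hS1, hS2⟩
  calc 2 * ((d : ℝ) + 1) * (creg * e ^ β * (1 + D1 thetaProf * (((d : ℝ) + 1) * S) / K))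
      = 2 * ((d : ℝ) + 1) * (creg * (1 + D1 thetaProf * (((d : ℝ) + 1) * S) / K)) * e ^ β := by ring
    _ ≤ 1 := hT

end Threshold

/-! ## §4. (2.16), the Hölder member, at `Ã_j` for a (1.7)-regular field -/

section Main

variable {ι : Type} [Fintype ι] [DecidableEq ι]

/-- **LEMMA 2.2 (2.16), HÖLDER MEMBER, AT THE CUBE CONFIGURATION OF A (1.7)-REGULAR FIELD, WITH ONLY «e SUFFICIENTLY
SMALL»**: there is `C > 0` (for `0 ≤ α < 1`; Lemma 2.2 at charge `1`) such that for every regularity pair `(c, β)`,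
`β > 0`, side bound `S` and cube size `K ≥ 1` there is `e₁ > 0` with: for every mesh `n = L^k` (`nK ≥ 16`), every
`a, m²` of the windows, every box `□ = Π_μ[0, nM_μ)` (`M_μ ≤ S`), every label `j` with its cube inside (`j_μ ≥ 1`,
`K(j_μ + 1) ≤ M_μ`), EVERY vector field `A` regular on `□` in the sense (1.7), every charge `0 < e ≤ e₁`, every
direction `μ`, sites `x ≠ x′` whose forward `μ`-bonds lie in `□`, every nearest-neighbour chain `Γ` from `x` to `x′`
with `|Γ| ≤ (d+1)|x′ − x|_∞` and every `Φ`: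
`(n/|x′ − x|_∞)^α·|U(Ã_j(Γ))(D^η_{Ã_j,μ}G_k(□,Ã_j)Φ)(x′) − (D^η_{Ã_j,μ}G_k(□,Ã_j)Φ)(x)| ≤ C‖Φ‖_∞` at coupling `e/n`
(staircase block contours) — the per-cube Hölder input of (1.9) at the interior cubes, reduced to (1.7).
[cite: Balaban1983RegularityDecay, Lemma 2.2 (2.16) p. 578 with (2.14) p. 577, §2 p. 575 (Ã_j), (1.7) p. 573, p. 581] -/
theorem lemma22_holder_cubeField (F : OrthFlow ι) {ℓ₁ : ℝ} (hℓ₁ : 0 ≤ ℓ₁)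
    (hLip : ∀ t (v : ι → ℝ), ((F.U t - 1) *ᵥ v) ⬝ᵥ ((F.U t - 1) *ᵥ v) ≤ (ℓ₁ * t) ^ 2 * (v ⬝ᵥ v))
    (d ℓ : ℕ) (hℓ : 1 ≤ ℓ) (amin aplus m2plus : ℝ) (ha : 0 < amin) (α : ℝ) (hα0 : 0 ≤ α) (hα1 : α < 1) :
    ∃ C : ℝ, 0 < C ∧ ∀ (creg β : ℝ), 0 ≤ creg → 0 < β → ∀ (S K : ℕ), 1 ≤ K →
      ∃ e₁ : ℝ, 0 < e₁ ∧ ∀ (k : ℕ), 1 ≤ k → ∀ (hn : 1 ≤ (ℓ + 1) ^ k), 16 ≤ (ℓ + 1) ^ k * K →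
      ∀ (a m2 : ℝ), amin ≤ a → a ≤ aplus → 0 ≤ m2 → m2 ≤ m2plus →
      ∀ (M : Fin (d + 1) → ℕ), (∀ i, 1 ≤ M i) → (∀ i, M i ≤ S) →
      ∀ (j : Fin (d + 1) → ℤ), (∀ μ, 1 ≤ j μ) → (∀ μ, (K : ℤ) * (j μ + 1) ≤ M μ) →
      ∀ (Ac : (Fin (d + 1) → ℤ) → Fin (d + 1) → ℝ) (e : ℝ), 0 < e → e ≤ e₁ →
        (∀ x ∈ Box d ℓ k M, ∀ μ ν : Fin (d + 1),
          |Ac (x + e1 μ) ν - Ac x ν| ≤ creg * e ^ (β - 1) / ((ℓ + 1) ^ k : ℕ)) →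
      ∀ (μ : Fin (d + 1)) (x xe x' xe' : ↥(Box d ℓ k M)),
        xe.1 = x.1 + e1 μ → xe'.1 = x'.1 + e1 μ → x'.1 ≠ x.1 →
      ∀ (l : List ↥(Box d ℓ k M)), IsNNChain x l → pathEnd x l = x' →
        (l.length : ℝ) ≤ ((d : ℝ) + 1) * supNorm (x'.1 - x.1) →
      ∀ Φ : ↥(Box d ℓ k M) × ι → ℝ,
        ((((ℓ + 1) ^ k : ℕ) : ℝ) / supNorm (x'.1 - x.1)) ^ α *
          siteNorm (transport (fieldLink F (e / ((ℓ + 1) ^ k : ℕ))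
                (cubeField (Box d ℓ k M) ((ℓ + 1) ^ k) K j (Ac 0) Ac)) x l
              *ᵥ fld (derivA d F (e / ((ℓ + 1) ^ k : ℕ)) ℓ k M (cubeField (Box d ℓ k M) ((ℓ + 1) ^ k) K j (Ac 0) Ac) μ
                    *ᵥ (greenA d F (e / ((ℓ + 1) ^ k : ℕ)) ℓ k a m2 M (baseEmb hn M) (stairContour hn M)
                        (cubeField (Box d ℓ k M) ((ℓ + 1) ^ k) K j (Ac 0) Ac) *ᵥ Φ)) x'
            - fld (derivA d F (e / ((ℓ + 1) ^ k : ℕ)) ℓ k M (cubeField (Box d ℓ k M) ((ℓ + 1) ^ k) K j (Ac 0) Ac) μ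
                    *ᵥ (greenA d F (e / ((ℓ + 1) ^ k : ℕ)) ℓ k a m2 M (baseEmb hn M) (stairContour hn M)
                        (cubeField (Box d ℓ k M) ((ℓ + 1) ^ k) K j (Ac 0) Ac) *ᵥ Φ)) x)
          ≤ C * supN Φ := by
  obtain ⟨c, c₁, hc, hc₁, hL⟩ := lemma22_16_holder_field_explicit F hℓ₁ hLip 1 d ℓ hℓ amin aplus m2plus ha α hα0 hα1
  refine ⟨2 * c₁, by positivity, fun creg β hcreg hβ S K hK1 => ?_⟩
  obtain ⟨e₁, he₁, hth⟩ := holder_threshold d (c := c) (aplus := aplus) hℓ₁ hc.le ha hcreg hβ S K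
  refine ⟨e₁, he₁, ?_⟩
  intro k hk hn hnK a m2 e1' e2 e3 e4 M hM hS j hjlo hjhi Ac e he hle h17 μ x xe x' xe' hxe hxe' hne l hl hlend hlen Φ
  have hnr : (0 : ℝ) < ((ℓ + 1) ^ k : ℕ) := by exact_mod_cast hn
  -- the scaled fluctuation, the scaled constant part, the sizes
  set A' : ↥(Box d ℓ k M) → ↥(Box d ℓ k M) → ℝ :=
    fun u v => e / ((ℓ + 1) ^ k : ℕ) * cubeFluct (Box d ℓ k M) ((ℓ + 1) ^ k) K j (Ac 0) Ac u v with hA'_def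
  set A₀' : Fin (d + 1) → ℝ := fun ν => e / ((ℓ + 1) ^ k : ℕ) * Ac 0 ν with hA₀'_def
  set θ : ℝ := ((d : ℝ) + 1) * S * creg * e ^ β with hθ_def
  set θ₂ : ℝ := creg * e ^ β * (1 + D1 thetaProf * (((d : ℝ) + 1) * S) / K) with hθ₂_def
  -- the window, the threshold, the field hypotheses
  obtain ⟨hak1, hak2⟩ := aSeq_window hℓ hk ha e1' e2
  obtain ⟨hθ1, hθT1, hsm2, hsm⟩ := hth e he hle _ hak1 hak2
  obtain ⟨-, hA', hder, hbd⟩ := cubeField_hyps (d := d) hn hS hK1 hnK hjlo hjhi hcreg he h17 (β := β)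
  have hA'2 : ∀ x y : ↥(Box d ℓ k M), y.1 ∈ nbrs x.1 → |1 * A' x y| ≤ θ / ((ℓ + 1) ^ k : ℕ) := hA'
  have hder2 : ∀ (x z y : ↥(Box d ℓ k M)) (μ : Fin (d + 1)), z.1 = x.1 + e1 μ → y.1 = z.1 + e1 μ →
      |1 * (A' y z - A' z x)| ≤ θ₂ / (((ℓ + 1) ^ k : ℕ) : ℝ) ^ 2 ∧
      |1 * (A' x z - A' z y)| ≤ θ₂ / (((ℓ + 1) ^ k : ℕ) : ℝ) ^ 2 := hder
  have hbd2 : ∀ (x y : ↥(Box d ℓ k M)) (μ : Fin (d + 1)), y.1 = x.1 + e1 μ →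
      (x.1 - e1 μ ∉ Box d ℓ k M ∨ y.1 + e1 μ ∉ Box d ℓ k M) → A' x y = 0 ∧ A' y x = 0 := hbd
  have hD : 0 ≤ D1 thetaProf := D1_nonneg contDiff_thetaProf hasCompactSupport_thetaProf
  have heβ : 0 ≤ e ^ β := (Real.rpow_pos_of_pos he β).le
  have hθ0 : 0 ≤ θ := by rw [hθ_def]; positivity
  have hθ₂0 : 0 ≤ θ₂ := by rw [hθ₂_def]; positivity
  have hθT0 : 0 ≤ 2 * ((d : ℝ) + 1) * θ₂ := by positivity
  have ha' : 0 < a := lt_of_lt_of_le ha e1'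
  -- invertibility (gen 4) at the fluctuation field
  have hunit : IsUnit (opA d F 1 ℓ k a m2 M (baseEmb hn M) (stairContour hn M)
      (constBond (0 : Fin (d + 1) → ℝ) Subtype.val + A')).det :=
    opA_stair_isUnit_det F 1 hℓ hk hn ha' e3 M _
  -- the vacuous size of the zero constant part
  have hA0 : ∀ ν, |1 * (0 : Fin (d + 1) → ℝ) ν| ≤ θ / ((ℓ + 1) ^ k : ℕ) := fun ν => by
    rw [Pi.zero_apply, mul_zero, abs_zero]; positivity
  -- the transverse Lipschitz bound (§1)
  have hN : ∀ i, 1 ≤ (ℓ + 1) ^ k * M i := fun i => le_trans hn (Nat.le_mul_of_pos_right _ (hM i))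
  have hT : ∀ i, (((ℓ + 1) ^ k * M i : ℕ) : ℤ) ≤ (((ℓ + 1) ^ k : ℕ) : ℤ) * S := fun i => by
    push_cast; exact mul_le_mul_of_nonneg_left (by exact_mod_cast hS i) (by positivity)
  have hδ : 0 ≤ creg * e ^ (β - 1) / ((ℓ + 1) ^ k : ℕ) := by positivity
  have hA'' : ∀ (ν : Fin (d + 1)) (u ue u' ue' : ↥(Box d ℓ k M)), ue.1 = u.1 + e1 ν → ue'.1 = u'.1 + e1 ν →
      |1 * (A' u' ue' - A' u ue)|
        ≤ 2 * ((d : ℝ) + 1) * θ₂ * supNorm (u'.1 - u.1) / (((ℓ + 1) ^ k : ℕ) : ℝ) ^ 2 := by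
    intro ν u ue u' ue' hue hue'
    have hb := abs_cubeComp_sub_le hN hT hδ h17 hn hK1 j u.2 u'.2 ν
    rw [one_mul, hA'_def]
    dsimp only
    rw [cubeFluct_fwd_eq ((ℓ + 1) ^ k) K j (Ac 0) Ac hue, cubeFluct_fwd_eq ((ℓ + 1) ^ k) K j (Ac 0) Ac hue',
      ← mul_sub,
      show cubeComp ((ℓ + 1) ^ k) K j (Ac 0) Ac u'.1 ν - Ac 0 ν - (cubeComp ((ℓ + 1) ^ k) K j (Ac 0) Ac u.1 ν - Ac 0 ν)
        = cubeComp ((ℓ + 1) ^ k) K j (Ac 0) Ac u'.1 ν - cubeComp ((ℓ + 1) ^ k) K j (Ac 0) Ac u.1 ν by ring,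
      abs_mul, abs_of_pos (by positivity : (0 : ℝ) < e / ((ℓ + 1) ^ k : ℕ))]
    calc e / ((ℓ + 1) ^ k : ℕ) * |cubeComp ((ℓ + 1) ^ k) K j (Ac 0) Ac u'.1 ν - cubeComp ((ℓ + 1) ^ k) K j (Ac 0) Ac u.1 ν|
        ≤ e / ((ℓ + 1) ^ k : ℕ) * (2 * (((d : ℝ) + 1) * supNorm (u'.1 - u.1))
            * (creg * e ^ (β - 1) / ((ℓ + 1) ^ k : ℕ)
              * (1 + D1 thetaProf * (((d : ℝ) + 1) * ((((ℓ + 1) ^ k : ℕ) : ℤ) * S : ℤ))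
                / ((((ℓ + 1) ^ k : ℕ) : ℝ) * K)))) := mul_le_mul_of_nonneg_left hb (by positivity)
      _ = 2 * ((d : ℝ) + 1) * (creg * (e * e ^ (β - 1)) * (1 + D1 thetaProf * (((d : ℝ) + 1) * S) / K))
            * supNorm (u'.1 - u.1) / (((ℓ + 1) ^ k : ℕ) : ℝ) ^ 2 := by
          push_cast; field_simp
      _ = 2 * ((d : ℝ) + 1) * θ₂ * supNorm (u'.1 - u.1) / (((ℓ + 1) ^ k : ℕ) : ℝ) ^ 2 := by
          rw [hθ₂_def, Real.rpow_sub_one he.ne', mul_div_cancel₀ _ he.ne']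
  -- the contour sums along the staircases
  have hτ : ∀ y x, blkWt ((ℓ + 1) ^ k) M (fun i => (ℓ + 1) ^ k * M i) y x ≠ 0 →
      |1 * lsum A' (baseEmb hn M y) (stairContour hn M y x)| ≤ ((d : ℝ) + 1) * θ :=
    fun y x _ => stair_lsum_le 1 hn M hθ0 hA'2 y x
  have hτ0 : 0 ≤ ((d : ℝ) + 1) * θ := by positivity
  -- the gauge that puts the constant part back
  set σ : ↥(Box d ℓ k M) → ℝ := linGauge A₀' Subtype.val with hσ
  set g : ↥(Box d ℓ k M) → Matrix ι ι ℝ := fun u => F.U (1 * σ u) with hg_def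
  have hg : IsGauge g := F.isGauge _
  -- the lineage's certificate at charge 1, constant part 0, fluctuation A', source 𝒢ᵀΦ
  have main := hL k hk a m2 e1' e2 e3 e4 M hM (baseEmb hn M) (stairContour hn M)
    (fun y x hw => stairContour_end hn M y x hw) 0 A' θ (2 * ((d : ℝ) + 1) * θ₂) θ₂ (((d : ℝ) + 1) * θ)
    hunit hθ0 hθ1 hA0 hA'2 hθT0 hθT1 hA'' hθ₂0 hder2 hbd2 hτ0 hτ hsm μ x xe x' xe' hxe hxe' hne l hl hlend hlen
    ((blockDiag g)ᵀ *ᵥ Φ)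
  rw [constBond_zero, zero_add, supN_gauge_transpose hg] at main
  -- put back the charge and the constant part: (e/n)Ã_j = (A')^σ
  have hfield : (fun u v => e / ((ℓ + 1) ^ k : ℕ) * cubeField (Box d ℓ k M) ((ℓ + 1) ^ k) K j (Ac 0) Ac u v)
      = bondGauge σ A' := by
    rw [smul_cubeField, hσ, ← constBond_add_eq_bondGauge]
  have hW : fieldLink F (e / ((ℓ + 1) ^ k : ℕ)) (cubeField (Box d ℓ k M) ((ℓ + 1) ^ k) K j (Ac 0) Ac)
      = gaugeKer g g (fieldLink F 1 A') := by
    rw [fieldLink_smul, hfield, fieldLink_bondGauge]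
  have hTr : transport (fieldLink F (e / ((ℓ + 1) ^ k : ℕ)) (cubeField (Box d ℓ k M) ((ℓ + 1) ^ k) K j (Ac 0) Ac)) x l
      = g x * transport (fieldLink F 1 A') x l * (g x')ᵀ := by
    rw [hW, transport_gauge hg, hlend]
  have hDer : derivA d F (e / ((ℓ + 1) ^ k : ℕ)) ℓ k M (cubeField (Box d ℓ k M) ((ℓ + 1) ^ k) K j (Ac 0) Ac) μ
      = blockDiag g * derivA d F 1 ℓ k M A' μ * (blockDiag g)ᵀ := by
    unfold derivA
    rw [hW, covDeriv_gauge hg]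
  have hGr : greenA d F (e / ((ℓ + 1) ^ k : ℕ)) ℓ k a m2 M (baseEmb hn M) (stairContour hn M)
        (cubeField (Box d ℓ k M) ((ℓ + 1) ^ k) K j (Ac 0) Ac)
      = blockDiag g * greenA d F 1 ℓ k a m2 M (baseEmb hn M) (stairContour hn M) A' * (blockDiag g)ᵀ := by
    rw [greenA_smul, hfield]
    unfold greenA
    rw [b4Green_bondGauge F 1 _ m2 _ (fun y x hw => stairContour_end hn M y x hw) σ A']
  rw [hTr, hDer, hGr, holder_gauge hg]
  exact main

end Main

end

end Literature.MathematicalPhysics.QuantumFieldTheory.Balaban1983to89.B4Lemma22HolderCubeField
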